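import Mathlib
import Summits.KontsevichZagierPeriods.Zeta5Search.SecondOrderTransfer
import Summits.KontsevichZagierPeriods.Zeta5Search.ResidueLaw
import HarnessLib

/-!
# ζ(5) search — the type-space law (zero regime): orbit points, their conjugation symmetry and their transport to `b + e_j`

Cell `pub-zeta5` (HONEST FRAMING: systematic search; no irrationality claim unless certified), typer seat generation 11.
REPORT-gen2-g11 §4 for the tree statement `ResidueLaw.TypeSpaceLawZero` (the AFFINE generalisation of THEOREM A‴: the doubled orbit points
`P_x = (pointW, pointV)` of the live classes are affinely collinear mod `p`).  Regime: every pole class has `E ≥ −M`; pole classes of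
exponent `−M` are non-self-conjugate with palindromic type list.  This file supplies
* `tau_conj_of_pal` — a palindromic non-self-conjugate class and its conjugate have the same `τ` (so `P_x = 2τ_x` on deep classes, `pointW_deep`,
  `pointV_deep`);
* `sub_pair_point` — for a pole class `y` of exponent `−M+1`: `ĝ_yŵ_y + ĝ_ȳŵ_ȳ ≡ (ĝ_y/4)·pointW y + (ĝ_ȳ/4)·pointW ȳ (mod p)` (same for `V`),
  uniformly in live/tame and in the centre status;
* `point_transfer` — a live class of `b + e_j` is a live class of `b` with the SAME point (`deep`: unhit; sub-deep: unhit, or a hit deep class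
  whose new type is a single raise of its palindromic type, `live_pair`).
`p`-adic bookkeeping of a systematic search; nothing here bears on irrationality.
-/

noncomputable section

open Finset

namespace Summit.KontsevichZagierPeriods.Zeta5Search.SecondOrder

open Summit.KontsevichZagierPeriods.Zeta5Search.DualSeries (InBox)
open Summit.KontsevichZagierPeriods.Zeta5Search.CasoratianValuation (InPolytope shift)
open Summit.KontsevichZagierPeriods.Zeta5Search.ClusterValuation
open Summit.KontsevichZagierPeriods.Zeta5Search.PadicSeries
open Summit.KontsevichZagierPeriods.Zeta5Search.BigPrime (shift_zero)
open Summit.KontsevichZagierPeriods.Zeta5Search.CellKit (conj_level netExp_conj_level)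
open Summit.KontsevichZagierPeriods.Zeta5Search.ResidueLaw (pointW pointV liveClasses)

variable {p : ℕ} [hp : Fact p.Prime]

/-! ## §1 Conjugation symmetry of `τ` for palindromic classes -/

section Conj

variable (b : ℕ → ℤ) (hb : InPolytope b) (hpn : (p : ℤ) ≤ b 0) {x : ℕ} (hx : x < p) (hc : ¬ CentreIn b p x)
  (hpal : (classTypeList b p x).reverse = classTypeList b p x)
include hb hpn hx hc hpal

/-- **A palindromic non-self-conjugate class and its conjugate have the same `τ`.** -/
theorem tau_conj_of_pal :
    tauW b p (conjClass b p x) = tauW b p x ∧ tauV b p (conjClass b p x) = tauV b p x := by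
  have h0 : 0 ≤ b 0 := hb.1.1
  have hxn := le_b0_of_lt b hpn hx
  obtain ⟨hL, hL'⟩ := level_bounds' (p := p) b hxn
  obtain ⟨htop, he⟩ := spec_of_typeList b hxn (T := classTypeList b p x) rfl
  set L := topLevel b p x with hLdef
  set f : ℕ → ℤ := fun k => netExp b (x + k * p) with hfdef
  have hf : ∀ k ≤ L, netExp b (x + k * p) = f k := fun k _ => rfl
  have hpalf : ∀ k ≤ L, f (L - k) = f k := by
    intro k hk
    show netExp b (x + (L - k) * p) = netExp b (x + k * p)
    rw [he k hk, he (L - k) (by omega), ← htop]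
    exact tList_pal hpal k (by omega)
  obtain ⟨hx', hM2, hM2'⟩ := conj_level b hx hL hL'
  have hfc : ∀ k ≤ L, netExp b (conjClass b p x + k * p) = f (L - k) := fun k hk => netExp_conj_level b hL hL' h0 hk
  have hc0 : ¬ (¬ (2 : ℤ) ∣ b 0 ∧ CentreIn b p x) := fun h => hc h.2
  have hc0' : ¬ (¬ (2 : ℤ) ∣ b 0 ∧ CentreIn b p (conjClass b p x)) :=
    fun h => hc ((centreIn_conj_iff b h0 hxn).1 h.2)
  constructor
  · rw [tauW_level₀ b hx' hM2 hM2' _ hfc hc0', tauW_level₀ b hx hL hL' f hf hc0]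
    exact typeTauW_congr hpalf
  · rw [tauV_level₀ b hx' hM2 hM2' _ hfc hc0', tauV_level₀ b hx hL hL' f hf hc0]
    exact typeTauV_congr hpalf

/-- On a deep class (`E_x = −M`, palindromic, non-self-conjugate) the doubled orbit point is `2τ_x`. -/
theorem pointW_deep {M : ℕ} (hE : classExp b p x = -(M : ℤ)) : pointW b p M x = 2 * tauW b p x := by
  unfold pointW; rw [if_pos hE, (tau_conj_of_pal b hb hpn hx hc hpal).1]; ring

/-- Second coordinate of `pointW_deep`. -/
theorem pointV_deep {M : ℕ} (hE : classExp b p x = -(M : ℤ)) : pointV b p M x = 2 * tauV b p x := by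
  unfold pointV; rw [if_pos hE, (tau_conj_of_pal b hb hpn hx hc hpal).2]; ring

end Conj

/-! ## §2 The pair of a sub-deep class in terms of orbit points -/

section SubPair

variable (b : ℕ → ℤ) (hb : InPolytope b) (hp5 : 5 ≤ p) (hpn : (p : ℤ) ≤ b 0) (hwin : (b 0 + 2 : ℤ) < (p : ℤ) ^ 2)
  {M : ℕ} (hM : 6 ≤ M) (hMe : Even M)
include hb hp5 hpn hwin hM hMe

omit hM in
/-- **The pair of a sub-deep class is carried by the orbit points, with the uniform weight `ĝ/4`**: for a pole class `y` of exponent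
`−M+1`, `‖ĝ_yŵ_y + ĝ_ȳŵ_ȳ − ((ĝ_y/4)·pointW y + (ĝ_ȳ/4)·pointW ȳ)‖ ≤ p⁻¹`, and the same for `V`. -/
theorem sub_pair_point {y : ℕ} (hy : y < p) (hE : classExp b p y = -(M : ℤ) + 1) :
    padicNorm p (gHat b p y * wHat b p y + gHat b p (conjClass b p y) * wHat b p (conjClass b p y)
        - (gHat b p y / 4 * pointW b p M y + gHat b p (conjClass b p y) / 4 * pointW b p M (conjClass b p y)))
        ≤ (p : ℚ) ^ (-(1 : ℤ)) ∧
      padicNorm p (gHat b p y * vHat b p y + gHat b p (conjClass b p y) * vHat b p (conjClass b p y)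
        - (gHat b p y / 4 * pointV b p M y + gHat b p (conjClass b p y) / 4 * pointV b p M (conjClass b p y)))
        ≤ (p : ℚ) ^ (-(1 : ℤ)) := by
  have h0 : 0 ≤ b 0 := hb.1.1
  have hp0 : 0 < p := hp.out.pos
  have hp2 : p ≠ 2 := by omega
  obtain ⟨-, -, -, hn⟩ := thmA_data b hb hwin
  have hpn' : p ≤ (b 0).toNat := by have := hb.1.1; omega
  have hyn : y ≤ (b 0).toNat := le_b0_of_lt b hpn hy
  obtain ⟨hL, hL'⟩ := level_bounds' (p := p) b hyn
  have hEc : classExp b p (conjClass b p y) = -(M : ℤ) + 1 := by rw [classExp_conj b h0 hyn]; exact hE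
  have hcc : conjClass b p (conjClass b p y) = y := conjClass_conjClass b hy hpn'
  have hw1 : ∀ z, padicNorm p (wHat b p z) ≤ 1 := fun z => LevelClass.padicNorm_wHat_le_one b h0 hn hp2 z
  have hv1 : ∀ z, padicNorm p (vHat b p z) ≤ 1 := fun z => LevelClass.padicNorm_vHat_le_one b h0 hn hp2
  have h2n : padicNorm p (2 : ℚ) = 1 := padicNorm_two hp2
  have hhalf : padicNorm p ((1 : ℚ) / 2) = 1 := by rw [padicNorm.div, padicNorm.one, h2n, div_one]
  have hEne : classExp b p y ≠ -(M : ℤ) := by omega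
  have hEne' : classExp b p (conjClass b p y) ≠ -(M : ℤ) := by omega
  by_cases hcen : CentreIn b p y
  · -- the self-conjugate class: `ȳ = y`, `P = 4σ`
    have hself : conjClass b p y = y := (centreIn_iff_conjClass_eq b hpn' hy).1 hcen
    have hPW : pointW b p M y = 4 * wHat b p y := by unfold pointW; rw [if_neg hEne, if_pos hcen]
    have hPV : pointV b p M y = 4 * vHat b p y := by unfold pointV; rw [if_neg hEne, if_pos hcen]
    rw [hself, hPW, hPV]
    have eW : gHat b p y * wHat b p y + gHat b p y * wHat b p y
        - (gHat b p y / 4 * (4 * wHat b p y) + gHat b p y / 4 * (4 * wHat b p y)) = 0 := by ring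
    have eV : gHat b p y * vHat b p y + gHat b p y * vHat b p y
        - (gHat b p y / 4 * (4 * vHat b p y) + gHat b p y / 4 * (4 * vHat b p y)) = 0 := by ring
    rw [eW, eV, padicNorm.zero]
    exact ⟨zpow_p_nonneg _, zpow_p_nonneg _⟩
  · -- a conjugate pair: `P_y = P_ȳ = 2(σ_y + σ_ȳ)`
    have hcenc : ¬ CentreIn b p (conjClass b p y) := fun h => hcen ((centreIn_conj_iff b h0 hyn).1 h)
    have hPW : pointW b p M y = 2 * (wHat b p y + wHat b p (conjClass b p y)) := by
      unfold pointW orbitW; rw [if_neg hEne, if_neg hcen, if_neg hcen]; rfl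
    have hPV : pointV b p M y = 2 * (vHat b p y + vHat b p (conjClass b p y)) := by
      unfold pointV orbitV; rw [if_neg hEne, if_neg hcen, if_neg hcen]; rfl
    have hPW' : pointW b p M (conjClass b p y) = 2 * (wHat b p (conjClass b p y) + wHat b p y) := by
      unfold pointW orbitW; rw [if_neg hEne', if_neg hcenc, if_neg hcenc]
      exact congrArg _ (congrArg _ (congrArg _ hcc))
    have hPV' : pointV b p M (conjClass b p y) = 2 * (vHat b p (conjClass b p y) + vHat b p y) := by
      unfold pointV orbitV; rw [if_neg hEne', if_neg hcenc, if_neg hcenc]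
      exact congrArg _ (congrArg _ (congrArg _ hcc))
    have hodd : Odd (classExp b p y) := by rw [hE]; obtain ⟨r, hr⟩ := hMe; exact ⟨-(r : ℤ), by omega⟩
    have hgg := gHat_pair_first b hb hp5 hy hL hL' hcen hodd
    rw [hPW, hPV, hPW', hPV']
    have eW : gHat b p y * wHat b p y + gHat b p (conjClass b p y) * wHat b p (conjClass b p y)
        - (gHat b p y / 4 * (2 * (wHat b p y + wHat b p (conjClass b p y)))
          + gHat b p (conjClass b p y) / 4 * (2 * (wHat b p (conjClass b p y) + wHat b p y))) =
        (1 : ℚ) / 2 * ((gHat b p (conjClass b p y) - gHat b p y) * (wHat b p (conjClass b p y) - wHat b p y)) := by ring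
    have eV : gHat b p y * vHat b p y + gHat b p (conjClass b p y) * vHat b p (conjClass b p y)
        - (gHat b p y / 4 * (2 * (vHat b p y + vHat b p (conjClass b p y)))
          + gHat b p (conjClass b p y) / 4 * (2 * (vHat b p (conjClass b p y) + vHat b p y))) =
        (1 : ℚ) / 2 * ((gHat b p (conjClass b p y) - gHat b p y) * (vHat b p (conjClass b p y) - vHat b p y)) := by ring
    have hsmall : ∀ {c : ℚ}, padicNorm p c ≤ 1 →
        padicNorm p ((1 : ℚ) / 2 * ((gHat b p (conjClass b p y) - gHat b p y) * c)) ≤ (p : ℚ) ^ (-(1 : ℤ)) := fun hc => by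
      rw [padicNorm.mul, hhalf, one_mul, padicNorm.mul]
      calc _ ≤ (p : ℚ) ^ (-(1 : ℤ)) * 1 := mul_le_mul hgg hc (padicNorm.nonneg _) (zpow_p_nonneg _)
        _ = _ := mul_one _
    rw [eW, eV]
    exact ⟨hsmall ((padicNorm.sub (p := p)).trans (max_le (hw1 _) (hw1 _))),
      hsmall ((padicNorm.sub (p := p)).trans (max_le (hv1 _) (hv1 _)))⟩

end SubPair

/-! ## §3 Transport of the orbit points to `b + e_j` -/

section Transfer

variable (b : ℕ → ℤ) {j : ℕ} (hb : InPolytope b) (hb' : InPolytope (shift b j)) (hj1 : 1 ≤ j) (hj7 : j ≤ 7)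
  (hpn : (p : ℤ) ≤ b 0) {M : ℕ} (hM : 6 ≤ M) (hMe : Even M)
  (G1 : ∀ x, x < p → 1 ≤ classPoleCount b p x → -(M : ℤ) ≤ classExp b p x)
  (G3 : ∀ x, x < p → 1 ≤ classPoleCount b p x → classExp b p x = -(M : ℤ) →
    ¬ CentreIn b p x ∧ (classTypeList b p x).reverse = classTypeList b p x)
include hb hb' hj1 hj7 hpn hM hMe G1 G3

omit hp hb' hj7 hpn hM hMe G3 in
/-- **The pole-class exponent bound transports.** -/
theorem G1_shift : ∀ x, x < p → 1 ≤ classPoleCount (shift b j) p x → -(M : ℤ) ≤ classExp (shift b j) p x := by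
  intro x hx h1
  have h1b : 1 ≤ classPoleCount b p x := le_trans h1 (classPoleCount_shift_le b hb.1 hj1 p x)
  exact (G1 x hx h1b).trans (classExp_shift_ge b hb.1 hj1 p x)

omit hM hMe in
/-- **The deep-class regime transports.** -/
theorem G3_shift : ∀ x, x < p → 1 ≤ classPoleCount (shift b j) p x → classExp (shift b j) p x = -(M : ℤ) →
    ¬ CentreIn (shift b j) p x ∧ (classTypeList (shift b j) p x).reverse = classTypeList (shift b j) p x := by
  intro x hx h1 hE
  have h1b : 1 ≤ classPoleCount b p x := le_trans h1 (classPoleCount_shift_le b hb.1 hj1 p x)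
  have hEb := G1 x hx h1b
  have hge := classExp_shift_ge b hb.1 hj1 p x
  have heq : classExp (shift b j) p x = classExp b p x := by omega
  obtain ⟨hc, hpal⟩ := G3 x hx h1b (by omega)
  refine ⟨fun h => hc ((centreIn_shift b hj1 p x).1 h), ?_⟩
  rw [classTypeList_shift_of_unhit b hb hb' hj1 hj7 heq (le_b0_of_lt b hpn hx)]
  exact hpal

/-- **Orbit points transport**: a live class of `b + e_j` is a live class of `b` with the same doubled orbit point. -/
theorem point_transfer {z : ℕ} (hz : z ∈ liveClasses (shift b j) p M) :
    z ∈ liveClasses b p M ∧ pointW (shift b j) p M z = pointW b p M z ∧ pointV (shift b j) p M z = pointV b p M z := by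
  have h0 : 0 ≤ b 0 := hb.1.1
  have h0' : 0 ≤ shift b j 0 := by rw [shift_zero b hj1]; exact h0
  obtain ⟨hzr, h1, hE⟩ := mem_filter.1 hz
  have hzp := mem_range.1 hzr
  have hzn : z ≤ (b 0).toNat := le_b0_of_lt b hpn hzp
  have hzn' : z ≤ (shift b j 0).toNat := by rw [shift_zero b hj1]; exact hzn
  have h1b : 1 ≤ classPoleCount b p z := le_trans h1 (classPoleCount_shift_le b hb.1 hj1 p z)
  have hEb := G1 z hzp h1b
  have hge := classExp_shift_ge b hb.1 hj1 p z
  have hcs : conjClass (shift b j) p z = conjClass b p z := by unfold conjClass; rw [shift_zero b hj1]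
  -- the conjugate class moves with the class
  have heqc : classExp (shift b j) p z = classExp b p z →
      classExp (shift b j) p (conjClass b p z) = classExp b p (conjClass b p z) := fun heq => by
    rw [← hcs, classExp_conj (shift b j) h0' hzn', hcs, classExp_conj b h0 hzn, heq]
  rcases hE with hE | hE
  · -- deep in `b + e_j`: unhit deep class of `b`
    have heq : classExp (shift b j) p z = classExp b p z := by omega
    have hEbm : classExp b p z = -(M : ℤ) := by omega
    refine ⟨mem_filter.2 ⟨hzr, h1b, Or.inl hEbm⟩, ?_, ?_⟩
    · unfold pointW
      rw [if_pos hE, if_pos hEbm, hcs, tauW_shift_of_classExp_eq b hb.1 hj1 heq,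
        tauW_shift_of_classExp_eq b hb.1 hj1 (heqc heq)]
    · unfold pointV
      rw [if_pos hE, if_pos hEbm, hcs, tauV_shift_of_classExp_eq b hb.1 hj1 heq,
        tauV_shift_of_classExp_eq b hb.1 hj1 (heqc heq)]
  · by_cases heq : classExp (shift b j) p z = classExp b p z
    · -- unhit sub-deep class
      have hEbm : classExp b p z = -(M : ℤ) + 1 := by omega
      have hne : classExp b p z ≠ -(M : ℤ) := by omega
      have hne' : classExp (shift b j) p z ≠ -(M : ℤ) := by omega
      refine ⟨mem_filter.2 ⟨hzr, h1b, Or.inr hEbm⟩, ?_, ?_⟩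
      · unfold pointW
        rw [if_neg hne', if_neg hne, wHat_shift_of_classExp_eq b hb.1 hj1 heq,
          orbitW_shift_of_classExp_eq b hb.1 hj1 heq (heqc heq)]
        simp only [centreIn_shift b hj1]
      · unfold pointV
        rw [if_neg hne', if_neg hne, vHat_shift_of_classExp_eq b hb.1 hj1 heq,
          orbitV_shift_of_classExp_eq b hb.1 hj1 heq (heqc heq)]
        simp only [centreIn_shift b hj1]
    · -- hit: a deep class of `b`, its new type a single raise of the palindromic old one
      have hEbm : classExp b p z = -(M : ℤ) := by omega
      obtain ⟨hc, hpal⟩ := G3 z hzp h1b hEbm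
      have hr := isRaise_of_hit b hb hb' hj1 hj7 hpn hzp (by omega)
      have hpn1 : (p : ℤ) ≤ shift b j 0 := by rw [shift_zero b hj1]; exact hpn
      obtain ⟨hw, hv⟩ := live_pair (shift b j) hb' hpn1 hpal hzp h1 (by omega) (Or.inl hr)
      have hodd : Odd (3 + classExp b p z) := by
        rw [hEbm]; obtain ⟨r, hr'⟩ := hMe; exact ⟨1 - (r : ℤ), by omega⟩
      obtain ⟨-, htw, htv, -⟩ := deep_data b hb hpn hpal hzp hc rfl hodd
      have hc' : ¬ CentreIn (shift b j) p z := fun h => hc ((centreIn_shift b hj1 p z).1 h)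
      have hne' : classExp (shift b j) p z ≠ -(M : ℤ) := by omega
      refine ⟨mem_filter.2 ⟨hzr, h1b, Or.inl hEbm⟩, ?_, ?_⟩
      · rw [pointW_deep b hb hpn hzp hc hpal hEbm]
        unfold pointW orbitW
        rw [if_neg hne', if_neg hc', if_neg hc', htw]
        show 2 * (wHat (shift b j) p z + wHat (shift b j) p (conjClass (shift b j) p z)) = _
        rw [hw]
      · rw [pointV_deep b hb hpn hzp hc hpal hEbm]
        unfold pointV orbitV
        rw [if_neg hne', if_neg hc', if_neg hc', htv]
        show 2 * (vHat (shift b j) p z + vHat (shift b j) p (conjClass (shift b j) p z)) = _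
        rw [hv]

end Transfer

end Summit.KontsevichZagierPeriods.Zeta5Search.SecondOrder

end
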